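import Literature.Geometry.GeometricMeasureTheory.ConeHomotopy
import Literature.Geometry.GeometricMeasureTheory.CurrentsRestrict
import HarnessLib

/-!
# Flat distance between a cycle and its dilate, by the conical defect

For a current of integration `T = [W, θ, ξ]` on the unit ball `B` of a finite-dimensional real
inner product space which is a CYCLE of finite mass, and its dilate
`μ_{s#} T = [s W, θ(·/s), ξ(·/s)]` (`0 < s ≤ 1`; data transported as in `HolomorphicChain.blowUp`,
so that for blow-ups `μ_{s#} D_r = D_{r/s}` on `B(0,s)`), the difference tested on a form `ψ`
supported in `B(0,s)` is the cone integral of `ConeHomotopy.lean`, whence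
(`abs_sub_dilate_apply_le`)

`|T(ψ) − (μ_{s#}T)(ψ)| ≤ (1 − s) · sup ‖dψ‖ · ∫_W |θ(y)| ‖y − z(y)‖ d𝓗^m(y)`

for any measurable choice `z(y) ∈ span ξ(y)` — with `z(y)` the orthogonal projection of `y` on the
approximate tangent plane this is `(1 − s) ‖dψ‖_∞ ∫ |θ| |y^⊥| d𝓗^m`, the **conical defect** of `T`
[Federer1969, 4.1.9 with 4.3.16]. Summed over dyadic scales, decay of the defect of the blow-ups
`D_r` gives their `𝓕^{loc}` convergence (tangent cones).

* `currentOfIntegration_dilate_apply` — `(μ_{s#}T)(ψ) = T(μ_s^* ψ) = ∫ θ ⟨s^m ψ(s y), ξ⟩ d𝓗^m`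
  (push-forward formula of `CurrentsDilation.lean` + restriction `CurrentsRestrict.lean`);
* `sub_dilate_apply_eq_integral_cone` — `T(ψ) − (μ_{s#}T)(ψ) =` the cone integral (homotopy formula);
* `abs_sub_dilate_apply_le` — the defect estimate.

No definitions, no named facts.

## References

* H. Federer, *Geometric Measure Theory*, Springer 1969, 4.1.9, 4.3.16 [Federer1969].
-/

open Filter MeasureTheory TopologicalSpace Set Metric
open scoped Topology Distributions Interval ENNReal

namespace Literature.Geometry.GeometricMeasureTheory

-- Nested operator-norm instances on (duals of) `E [⋀^Fin m]→L[ℝ] ℝ`, as in `Currents.lean`.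
set_option maxSynthPendingDepth 2

variable {V : Type*} [NormedAddCommGroup V] [InnerProductSpace ℝ V] [FiniteDimensional ℝ V]
  [MeasurableSpace V] [BorelSpace V] {k : ℕ} {B : Opens V}

omit [FiniteDimensional ℝ V] [MeasurableSpace V] [BorelSpace V] in
/-- A test form on `B` supported in the smaller ball `B(0,s) ⊆ B` is (the extension by zero of) a
test form on `B(0,s)`. [folklore] -/
theorem exists_testForm_of_tsupport_subset_ball (ψ : TestForm B (k + 1)) {s : ℝ}
    (hψs : tsupport ⇑ψ ⊆ Metric.ball (0 : V) s) :
    ∃ φ : TestForm (⟨Metric.ball (0 : V) s, Metric.isOpen_ball⟩ : Opens V) (k + 1), ∀ y, φ y = ψ y :=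
  ⟨⟨ψ, ψ.contDiff, ψ.hasCompactSupport, hψs⟩, fun _ => rfl⟩

omit [FiniteDimensional ℝ V] in
/-- Transport of GLOBAL summability under `A = s⁻¹ •` (`0 < s`): if `θ ξ` is `𝓗^m ⌞ W`-integrable
then `(θ ξ) ∘ A` is `𝓗^m ⌞ A⁻¹W`-integrable (`A_#(𝓗^m ⌞ A⁻¹W) = sᵐ 𝓗^m ⌞ W`). [cite: Federer1969, 4.3.16] -/
theorem integrable_comp_inv_smul {m : ℕ} {F : Type*} [NormedAddCommGroup F] {η : V → F} {W : Set V}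
    (hη : Integrable η ((μHE[m] : Measure V).restrict W)) {s : ℝ} (hs0 : 0 < s) :
    Integrable (fun y => η ((0 : V) + s⁻¹ • y))
      ((μHE[m] : Measure V).restrict ((fun y : V => (0 : V) + s⁻¹ • y) ⁻¹' W)) := by
  have hr : 0 < s⁻¹ := inv_pos.2 hs0
  let eA : V ≃ᵐ V :=
    ((Homeomorph.smulOfNeZero s⁻¹ hr.ne').trans (Homeomorph.addLeft (0 : V))).toMeasurableEquiv
  have heA : ⇑eA = fun y : V => (0 : V) + s⁻¹ • y := rfl
  have hmap := map_add_smul_restrict_preimage (m := m) (0 : V) hr W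
  have key : Integrable η (Measure.map eA
      ((μHE[m] : Measure V).restrict ((fun y : V => (0 : V) + s⁻¹ • y) ⁻¹' W))) := by
    rw [heA, hmap]
    exact hη.smul_measure ENNReal.ofReal_ne_top
  exact (integrable_map_equiv eA η).1 key

omit [FiniteDimensional ℝ V] in
/-- **The dilate evaluated: `(μ_{s#}T)(ψ) = T(μ_s^* ψ)`.** For summable data `[W, θ, ξ]` on the unit
ball `B` (`W` measurable, `θ ξ` `𝓗^{k+1} ⌞ W`-integrable), `0 < s ≤ 1` and `ψ` supported in
`B(0,s)`, the dilated current `μ_{s#}T = [s W ∩ B(0,s), θ(·/s), ξ(·/s)]` (formed on `B`, its data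
written as the pull-back under `A = s⁻¹ •` exactly as in `HolomorphicChain.blowUp`) satisfies
`(μ_{s#}T)(ψ) = ∫_W θ(y) (s^{k+1} ψ(s y))(ξ(y)) d𝓗^{k+1}(y) = T(μ_s^* ψ)`.
[cite: Federer1969, 4.1.9] -/
theorem currentOfIntegration_dilate_apply (hB : (B : Set V) = Metric.ball (0 : V) 1)
    {W : Set V} (hW : MeasurableSet W) (θ : V → ℤ) (ξ : V → Fin (k + 1) → V)
    (hintW : Integrable (fun x => (θ x : ℝ) • frameVector (ξ x))
      ((μHE[k + 1] : Measure V).restrict W))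
    {s : ℝ} (hs0 : 0 < s) (hs1 : s ≤ 1) (ψ : TestForm B (k + 1))
    (hψs : tsupport ⇑ψ ⊆ Metric.ball (0 : V) s) :
    (currentOfIntegration ((fun y : V => (0 : V) + s⁻¹ • y) ⁻¹' W ∩ Metric.ball (0 : V) s)
        (fun y => θ ((0 : V) + s⁻¹ • y)) (fun y => ξ ((0 : V) + s⁻¹ • y)) : Current B (k + 1)) ψ =
      ∫ y in W, (θ y : ℝ) * (s ^ (k + 1) • ψ (s • y)) (ξ y) ∂(μHE[k + 1] : Measure V) := by
  have hint : LocallyIntegrableOn (fun x => (θ x : ℝ) • frameVector (ξ x)) (B : Set V)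
      ((μHE[k + 1] : Measure V).restrict W) := hintW.locallyIntegrable.locallyIntegrableOn _
  -- the ball `B(0,s)` as an open set, and `ψ` on it
  set Bs : Opens V := ⟨Metric.ball (0 : V) s, Metric.isOpen_ball⟩ with hBs
  have hle : Bs ≤ B := by
    rw [← SetLike.coe_subset_coe, hB]
    exact Metric.ball_subset_ball hs1
  obtain ⟨φ, hφ⟩ := exists_testForm_of_tsupport_subset_ball ψ hψs
  have hA : (fun y : V => (0 : V) + s⁻¹ • y) '' (Bs : Set V) ⊆ B := by
    rw [hB]
    rintro _ ⟨y, hy, rfl⟩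
    have hy' : ‖y‖ < s := mem_ball_zero_iff.1 hy
    show (0 : V) + s⁻¹ • y ∈ Metric.ball (0 : V) 1
    rw [mem_ball_zero_iff, zero_add, norm_smul, norm_inv, Real.norm_of_nonneg hs0.le,
      inv_mul_lt_iff₀ hs0]
    linarith
  -- the dilated current formed on `B` restricts to the one formed on `B(0,s)`
  have hintA : LocallyIntegrableOn
      (fun y => ((θ ((0 : V) + s⁻¹ • y) : ℤ) : ℝ) • frameVector (ξ ((0 : V) + s⁻¹ • y)))
      (B : Set V) ((μHE[k + 1] : Measure V).restrict
        ((fun y : V => (0 : V) + s⁻¹ • y) ⁻¹' W ∩ Metric.ball (0 : V) s)) := by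
    have h := integrable_comp_inv_smul (η := fun x => (θ x : ℝ) • frameVector (ξ x)) hintW hs0
    exact (h.mono_measure (Measure.restrict_mono Set.inter_subset_left le_rfl)).locallyIntegrable
      |>.locallyIntegrableOn _
  have hrestr := congrArg (fun T : Current Bs (k + 1) => T φ)
    (currentOfIntegration_eq_comp_monoCLM hle hintA
      (W := (fun y : V => (0 : V) + s⁻¹ • y) ⁻¹' W ∩ Metric.ball (0 : V) s)
      (θ := fun y => θ ((0 : V) + s⁻¹ • y)) (ξ := fun y => ξ ((0 : V) + s⁻¹ • y)))
  have hmono : (TestFunction.monoCLM ℝ φ : TestForm B (k + 1)) = ψ := by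
    apply TestFunction.ext
    intro y
    rw [congrFun (TestForm.monoCLM_apply_of_le hle φ) y, hφ]
  simp only [ContinuousLinearMap.comp_apply, hmono] at hrestr
  -- hrestr : [dil]_{Bs} φ = [dil]_B ψ
  rw [← hrestr]
  -- push-forward formula on `Bs → B`
  obtain ⟨ψ₂, hψ₂⟩ := exists_testFunction_comp_add_smul (Ω₁ := Bs) (Ω₂ := B) (0 : V)
    (inv_pos.2 hs0).ne' hA φ
  have hφψ₂ : ∀ y, φ y = ψ₂ ((0 : V) + s⁻¹ • y) := fun y => by
    rw [hψ₂, add_sub_cancel_left, smul_smul, inv_inv, mul_inv_cancel₀ hs0.ne', one_smul]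
  have hpf := currentOfIntegration_preimage_add_smul_apply (Ω₁ := Bs) (Ω₂ := B) hW θ ξ (0 : V)
    (inv_pos.2 hs0) hA hint φ ψ₂ hφψ₂
  have hBs' : ((fun y : V => (0 : V) + s⁻¹ • y) ⁻¹' W ∩ (Bs : Set V)) =
      (fun y : V => (0 : V) + s⁻¹ • y) ⁻¹' W ∩ Metric.ball (0 : V) s := rfl
  rw [hBs'] at hpf
  rw [hpf, inv_inv, currentOfIntegration_apply hint, ← integral_const_mul]
  refine integral_congr_ae (Eventually.of_forall fun y => ?_)
  have e2 : ψ₂ y = ψ (s • y) := by rw [hψ₂, sub_zero, inv_inv, hφ]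
  simp only [e2, ContinuousAlternatingMap.smul_apply, smul_eq_mul]
  ring

/-- **`T(ψ) − (μ_{s#}T)(ψ)` is the cone integral** for a summable cycle `T = [W, θ, ξ]` on the unit
ball (`∂T = 0` on `B`, `𝓗^{k+1}(W) < ∞`), `0 < s ≤ 1`, `spt ψ ⊆ B(0,s)`:
`T(ψ) − (μ_{s#}T)(ψ) = ∫_W θ(y) ⟨∫_s^1 t^{k+1} ι_y dψ(t y) dt, ξ(y)⟩ d𝓗^{k+1}(y)`.
[cite: Federer1969, 4.1.9] -/
theorem sub_dilate_apply_eq_integral_cone (hB : (B : Set V) = Metric.ball (0 : V) 1)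
    {W : Set V} (hW : MeasurableSet W) (hWfin : (μHE[k + 1] : Measure V) W ≠ ∞) (θ : V → ℤ)
    (ξ : V → Fin (k + 1) → V)
    (hintW : Integrable (fun x => (θ x : ℝ) • frameVector (ξ x))
      ((μHE[k + 1] : Measure V).restrict W))
    (hcycle : Current.boundary (currentOfIntegration W θ ξ : Current B (k + 1)) = 0)
    {s : ℝ} (hs0 : 0 < s) (hs1 : s ≤ 1) (ψ : TestForm B (k + 1))
    (hψs : tsupport ⇑ψ ⊆ Metric.ball (0 : V) s) :
    (currentOfIntegration W θ ξ : Current B (k + 1)) ψ -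
      (currentOfIntegration ((fun y : V => (0 : V) + s⁻¹ • y) ⁻¹' W ∩ Metric.ball (0 : V) s)
        (fun y => θ ((0 : V) + s⁻¹ • y)) (fun y => ξ ((0 : V) + s⁻¹ • y)) : Current B (k + 1)) ψ =
      ∫ y in W, ((θ y : ℝ) • frameVector (ξ y))
        (∫ t in s..1, t ^ (k + 1) • (extDeriv ⇑ψ (t • y)).curryLeft y) ∂(μHE[k + 1] : Measure V) := by
  haveI : IsFiniteMeasure ((μHE[k + 1] : Measure V).restrict W) :=
    ⟨by rw [Measure.restrict_apply_univ]; exact lt_top_iff_ne_top.2 hWfin⟩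
  have hint : LocallyIntegrableOn (fun x => (θ x : ℝ) • frameVector (ξ x)) (B : Set V)
      ((μHE[k + 1] : Measure V).restrict W) := hintW.locallyIntegrable.locallyIntegrableOn _
  rw [currentOfIntegration_dilate_apply hB hW θ ξ hintW hs0 hs1 ψ hψs,
    currentOfIntegration_apply hint]
  have e : ∀ y, ((θ y : ℝ) • frameVector (ξ y)) (s ^ (k + 1) • ψ (s • y)) =
      (θ y : ℝ) * (s ^ (k + 1) • ψ (s • y)) (ξ y) := fun y => rfl
  have e' : ∀ y, ((θ y : ℝ) • frameVector (ξ y)) (ψ y) = (θ y : ℝ) * ψ y (ξ y) := fun y => rfl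
  have h := integral_apply_sub_pullback_eq hB hintW hcycle hs0 hs1 ψ hψs
  simp_rw [e, e'] at h
  exact h

set_option maxHeartbeats 400000 in
/-- **The conical-defect estimate of the flat distance between a cycle and its dilate**: under the
hypotheses of `sub_dilate_apply_eq_integral_cone`, with `ξ(y)` orthonormal and a measurable
choice `z(y) ∈ span ξ(y)` for a.e. `y ∈ W`, `|θ| ‖y − z(y)‖` summable, and `‖dψ(x)‖ ≤ M`:
`|T(ψ) − (μ_{s#}T)(ψ)| ≤ (1 − s) · M · ∫_W |θ(y)| ‖y − z(y)‖ d𝓗^{k+1}(y)`.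
With `z(y)` the orthogonal projection of `y` on the tangent plane the integral is the conical
defect `∫ |θ| |y^⊥| d𝓗^{k+1}` of `T`. [cite: Federer1969, 4.1.9] -/
theorem abs_sub_dilate_apply_le (hB : (B : Set V) = Metric.ball (0 : V) 1)
    {W : Set V} (hW : MeasurableSet W) (hWfin : (μHE[k + 1] : Measure V) W ≠ ∞) (θ : V → ℤ)
    (ξ : V → Fin (k + 1) → V) {z : V → V}
    (hintW : Integrable (fun x => (θ x : ℝ) • frameVector (ξ x))
      ((μHE[k + 1] : Measure V).restrict W))
    (hξ : ∀ᵐ y ∂((μHE[k + 1] : Measure V).restrict W),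
      Orthonormal ℝ (ξ y) ∧ z y ∈ Submodule.span ℝ (Set.range (ξ y)))
    (hθz : Integrable (fun y => |(θ y : ℝ)| * ‖y - z y‖) ((μHE[k + 1] : Measure V).restrict W))
    (hcycle : Current.boundary (currentOfIntegration W θ ξ : Current B (k + 1)) = 0)
    {s : ℝ} (hs0 : 0 < s) (hs1 : s ≤ 1) (ψ : TestForm B (k + 1))
    (hψs : tsupport ⇑ψ ⊆ Metric.ball (0 : V) s) {M : ℝ}
    (hM : ∀ x, ‖extDeriv ⇑ψ x‖ ≤ M) :
    |(currentOfIntegration W θ ξ : Current B (k + 1)) ψ -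
      (currentOfIntegration ((fun y : V => (0 : V) + s⁻¹ • y) ⁻¹' W ∩ Metric.ball (0 : V) s)
        (fun y => θ ((0 : V) + s⁻¹ • y)) (fun y => ξ ((0 : V) + s⁻¹ • y)) : Current B (k + 1)) ψ| ≤
      (1 - s) * M * ∫ y in W, |(θ y : ℝ)| * ‖y - z y‖ ∂(μHE[k + 1] : Measure V) := by
  have h := sub_dilate_apply_eq_integral_cone hB hW hWfin θ ξ hintW hcycle hs0 hs1 ψ hψs
  rw [h]
  obtain ⟨hdψ, -⟩ := exists_norm_extDeriv_le ⇑ψ ψ.contDiff (by simp) ψ.hasCompactSupport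
  refine abs_integral_cone_le hξ hθz (extDeriv ⇑ψ) hM hs0 hs1 (k + 1) fun y => ?_
  have hg : Continuous (fun t : ℝ => (extDeriv ⇑ψ (t • y)).curryLeft y) :=
    (isBoundedBilinearMap_curryLeft (V := V) (F := ℝ) (k := k + 1)).continuous.comp
      ((hdψ.comp (continuous_id.smul continuous_const)).prodMk continuous_const)
  have hc : Continuous (fun t : ℝ => t ^ (k + 1) • (extDeriv ⇑ψ (t • y)).curryLeft y) :=
    (continuous_pow (k + 1)).smul hg
  exact hc.intervalIntegrable s 1

/-! ### Currents of integration whose carriers agree near the support of the form -/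

omit [FiniteDimensional ℝ V] in
/-- **Locality in the carrier.** Two currents of integration with the same density and frame
whose (measurable) carriers agree inside an open set `U` take the same value on every test form
supported in `U` (both data locally summable, so both currents honest). Used to identify the
dilate `μ_{s#} D_r` of a blow-up with the blow-up `D_{r/s}` on forms supported in `B(0,s)`.
[cite: Federer1969, 4.1.7] -/
theorem currentOfIntegration_apply_eq_of_inter_eq {m : ℕ} {Ω : Opens V} {W₁ W₂ : Set V}
    (hW₁ : MeasurableSet W₁) (hW₂ : MeasurableSet W₂) {θ : V → ℤ} {ξ : V → Fin m → V}
    (h₁ : LocallyIntegrableOn (fun x => (θ x : ℝ) • frameVector (ξ x)) (Ω : Set V)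
      ((μHE[m] : Measure V).restrict W₁))
    (h₂ : LocallyIntegrableOn (fun x => (θ x : ℝ) • frameVector (ξ x)) (Ω : Set V)
      ((μHE[m] : Measure V).restrict W₂))
    {U : Set V} (hU : W₁ ∩ U = W₂ ∩ U) (φ : TestForm Ω m) (hφ : tsupport ⇑φ ⊆ U) :
    (currentOfIntegration W₁ θ ξ : Current Ω m) φ = (currentOfIntegration W₂ θ ξ : Current Ω m) φ := by
  rw [currentOfIntegration_apply h₁, currentOfIntegration_apply h₂]
  have hzero : ∀ W : Set V, ∀ x ∈ W \ (W ∩ U), (θ x : ℝ) * φ x (ξ x) = 0 := by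
    rintro W x ⟨hxW, hxU⟩
    have hx : x ∉ tsupport ⇑φ := fun h => hxU ⟨hxW, hφ h⟩
    rw [image_eq_zero_of_notMem_tsupport hx, ContinuousAlternatingMap.coe_zero, Pi.zero_apply,
      mul_zero]
  rw [setIntegral_eq_of_subset_of_forall_sdiff_eq_zero hW₁ Set.inter_subset_left (hzero W₁),
    setIntegral_eq_of_subset_of_forall_sdiff_eq_zero hW₂ Set.inter_subset_left (hzero W₂), hU]

end Literature.Geometry.GeometricMeasureTheory
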